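import Summits.HodgeConjecture.HodgeConjecture.Theorems.CyclicUnitaryPowersPLPackageOfLocalMonodromy
import Summits.HodgeConjecture.HodgeConjecture.Theorems.CyclicUnitaryPowersK1OfPrintNumbers

/-!
# K1 `VeryGeneralDeckCommutatorsInHg` of route `CyclicUnitaryPowers` from FOUR cited facts: the σ-free local monodromy
# of the `A_{p−1}` degeneration, two textbook numbers (`h^{2,0}`, `b₂` of a smooth surface in `ℙ³`) and the CDK cover
# (stmt-HodgeConjecture-19544; the JOINT composition of the two re-cuts of 2026-08-28, lanes Ax and Bx)

Prover seat `hodge-nonav-prover-Ax` (g9), cell `hodge-nonav`, on the route owner's coordination note (p3, 08:08:20Z: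
"converge on ONE joint theorem `(hF1† : F1†) (hPG : PG) (hB2 : B2) (hCDK : CDK)`"). Landed
`--supports stmt-HodgeConjecture-19544`; sorry-free, no definition, no new named fact. CONDITIONAL results; nothing here
says HC ∕ HC_AV is proved; rung F-H1 is not moved.

Inputs, all landed: lane Ax — `CyclicUnitaryPowersPLPackageOfLocalMonodromy.nonempty_carlsonToledoFamily_of_localMonodromy`
(the Carlson–Toledo structure at every prime `p ≥ 3` from F1† = `carlsonToledo1999_nodalMeridianLocalMonodromy`, the
deck identification being the recognition theorem `CyclicReflectionRecognition`); lane Bx — the junction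
`CyclicUnitaryPowersK1OfPrintNumbers.veryGeneralDeckCommutatorsInHg_of_prime_family_printNumbers` (K1 from the family
at primes `p ≥ 7`, PG = `Arapura2012_hypersurface_geometricGenus`, B2 = `EisenbudHarris2016_surface_secondBettiNumber`
— which give CT2's eigen-Hodge numbers, `finrank_eigenspace_inf_hodgePiece_prime_of_facts` — and CDK; CT1, CT71,
Deligne/CMSP 15.3.7 and Katz GKR being tree theorems).

* **`veryGeneralDeckCommutatorsInHg_of_localMonodromy_printNumbers (hF1 : F1†) (hPG : PG) (hB2 : B2) (hCDK : CDK)`** and the leaf twin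
  `cyclicSurfacePowersHodge_of_localMonodromy_printNumbers` — **K1-A ⟸ {σ-free local monodromy of `A_{p−1}`, `h^{2,0}(X_d) = C(d−1,3)`,
  `b₂(X_d) = d³ − 4d² + 6d − 2`, CDK}**.

## References

* [CarlsonToledo1999] J. A. Carlson, D. Toledo, Duke Math. J. 97 (1999), §2, §3, §5, §6, §7 Theorem 7.1.
* [CattaniDeligneKaplan1995] E. Cattani, P. Deligne, A. Kaplan, J. Amer. Math. Soc. 8 (1995), Thm. 1.1, Cor. 1.2.
* [Arapura2012] D. Arapura, Algebraic Geometry over the Complex Numbers, §17.3.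
* [EisenbudHarris2016] D. Eisenbud, J. Harris, 3264 and All That, Ex. 5.24 / Table 5.1.
-/

noncomputable section


set_option linter.dupNamespace false

namespace Summit.HodgeConjecture.HodgeConjecture.Theorems.CyclicUnitaryPowersK1OfLocalMonodromyPrintNumbers

open Literature.AlgebraicGeometry.Motives Literature.AlgebraicGeometry.HodgeTheory
open Summit.HodgeConjecture.HodgeConjecture.Theorems.CyclicUnitaryPowersK1OfPrintNumbers
open Summit.HodgeConjecture.HodgeConjecture.Theorems.CyclicUnitaryPowersPLPackageOfLocalMonodromy

/-- **K1 `VeryGeneralDeckCommutatorsInHg` from FOUR cited facts** — F1† (`carlsonToledo1999_nodalMeridianLocalMonodromy`: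
the σ-free local monodromy of the `A_{p−1}` degeneration at a one-nodal branch curve), PG (`h^{n,0}` of a smooth
hypersurface), B2 (`b₂` of a smooth surface in `ℙ³`), CDK (the Cattani–Deligne–Kaplan cover) — the joint composition of
lanes Ax (`nonempty_carlsonToledoFamily_of_localMonodromy`) and Bx (`veryGeneralDeckCommutatorsInHg_of_prime_family_printNumbers`).
CONDITIONAL; nothing here says HC ∕ HC_AV is proved.
[cite: CarlsonToledo1999, §2, §5, §6 (kdoublept), §7 Theorem 7.1] [cite: CattaniDeligneKaplan1995, Thm. 1.1 and Cor. 1.2] -/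
theorem veryGeneralDeckCommutatorsInHg_of_localMonodromy_printNumbers
    (hF1 : carlsonToledo1999_nodalMeridianLocalMonodromy)
    (hPG : Arapura2012_hypersurface_geometricGenus)
    (hB2 : EisenbudHarris2016_surface_secondBettiNumber)
    (hCDK : cmsp_nonHodgeGenericPoints_countable_algebraic_cover) :
    Summit.HodgeConjecture.HodgeConjecture.Theses.CyclicUnitaryPowers.VeryGeneralDeckCommutatorsInHg :=
  veryGeneralDeckCommutatorsInHg_of_prime_family_printNumbers
    (fun _ hp h7 => haveI : NeZero _ := ⟨hp.ne_zero⟩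
      nonempty_carlsonToledoFamily_of_localMonodromy hF1 hp (by omega)) @hPG @hB2 @hCDK

/-- **The rung leaf `CyclicSurfacePowersHodge` (stmt-HodgeConjecture-19543) from the same FOUR facts** (via the landed
fact-free step `cyclicSurfacePowersHodge_of_veryGeneralDeckCommutatorsInHg`). CONDITIONAL; rung F-H1 not moved.
[cite: CarlsonToledo1999, §2, §5, §6 (kdoublept), §7 Theorem 7.1] [cite: CattaniDeligneKaplan1995, Thm. 1.1 and Cor. 1.2] -/
theorem cyclicSurfacePowersHodge_of_localMonodromy_printNumbers
    (hF1 : carlsonToledo1999_nodalMeridianLocalMonodromy)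
    (hPG : Arapura2012_hypersurface_geometricGenus)
    (hB2 : EisenbudHarris2016_surface_secondBettiNumber)
    (hCDK : cmsp_nonHodgeGenericPoints_countable_algebraic_cover) :
    Summit.HodgeConjecture.HodgeConjecture.Theses.CyclicUnitaryPowers.CyclicSurfacePowersHodge :=
  CyclicUnitaryPowersCyclicSurfacePowersHodge.cyclicSurfacePowersHodge_of_veryGeneralDeckCommutatorsInHg
    (veryGeneralDeckCommutatorsInHg_of_localMonodromy_printNumbers @hF1 @hPG @hB2 @hCDK)

end Summit.HodgeConjecture.HodgeConjecture.Theorems.CyclicUnitaryPowersK1OfLocalMonodromyPrintNumbers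

end
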